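import Summits.CriticalPhenomena.PercolationContinuityZ3.Theses.PercNearOneGluing
import Literature.Probability.Percolation.PercolationProofs
import Literature.Probability.Percolation.ConditionalPositiveAssociationProofs
import Literature.Probability.Percolation.TwoClusterConditionalAssociationProofs

/-! TTRL-lite variant V1414 of stmt-CriticalPhenomena-4576 -/

namespace Summit.CriticalPhenomena.PercolationContinuityZ3.Theorems

open MeasureTheory Literature.Probability.LatticeModels Literature.Probability.Percolation
open scoped Classical BigOperators

/-- **Level form ↔ worst-relay form of the goodness inequality** (TTRL-lite variant V1414 of
stmt-CriticalPhenomena-4576).  Write `τ_a = μ(a ↔ b)` and, for a selection `sel`, let `L(sel)` be the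
left-hand side of the good-step inequality (escape mass plus the pocket sum).  The skeleton's
`(t, sel)` form "for every level `t` with `1 - t ≤ τ_a` for all relays `a ∈ A`, `L(sel) ≤ t`" is
equivalent to the max form "there is a relay `a ∈ A` with `L(sel) ≤ 1 - τ_a`": forward, take `a` a
minimiser of `τ` over `A` (nonempty since `b ∈ A`, `Finset.exists_min_image`) and the level
`t = 1 - τ_a`; backward, `1 - t ≤ τ_a` gives `1 - τ_a ≤ t`.  Pure logic; lets provers drop the level
parameter `t`. -/
theorem cp4576_goodstep_var1414 :
    ∀ (n : ℕ) (w : Sym2 (Fin n) → unitInterval) (A : Finset (Fin n)) (o b : Fin n), b ∈ A →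
      ((∀ (t : ℝ) (sel : Finset (Fin n) → Fin n), (∀ W, sel W ∈ A) →
          (∀ a ∈ A, 1 - t ≤ (prodBernoulli w).real (openConn a b)) →
            (prodBernoulli w).real ((⋃ a ∈ A, openConn o a) ∩ (openConn o b)ᶜ) +
                ∑ W ∈ (Finset.univ : Finset (Finset (Fin n))).filter
                    (fun W => o ∈ W ∧ Disjoint W A),
                  (prodBernoulli w).real
                      {ω : BondConfig (Fin n) | openCluster ω o = (W : Set (Fin n))} *
                    (prodBernoulli w).real (openConnIn ((W : Set (Fin n))ᶜ) (sel W) b)ᶜ ≤ t) ↔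
        (∀ (sel : Finset (Fin n) → Fin n), (∀ W, sel W ∈ A) →
          ∃ a ∈ A,
            (prodBernoulli w).real ((⋃ a ∈ A, openConn o a) ∩ (openConn o b)ᶜ) +
                ∑ W ∈ (Finset.univ : Finset (Finset (Fin n))).filter
                    (fun W => o ∈ W ∧ Disjoint W A),
                  (prodBernoulli w).real
                      {ω : BondConfig (Fin n) | openCluster ω o = (W : Set (Fin n))} *
                    (prodBernoulli w).real (openConnIn ((W : Set (Fin n))ᶜ) (sel W) b)ᶜ ≤
              1 - (prodBernoulli w).real (openConn a b))) := by
  intro n w A o b hb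
  constructor
  · intro h sel hsel
    obtain ⟨a, ha, hmin⟩ :=
      Finset.exists_min_image A (fun a => (prodBernoulli w).real (openConn a b)) ⟨b, hb⟩
    refine ⟨a, ha, ?_⟩
    refine h (1 - (prodBernoulli w).real (openConn a b)) sel hsel ?_
    intro a' ha'
    have hle := hmin a' ha'
    linarith
  · intro h t sel hsel ht
    obtain ⟨a, ha, hle⟩ := h sel hsel
    have hta := ht a ha
    linarith

end Summit.CriticalPhenomena.PercolationContinuityZ3.Theorems
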